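import Literature.AnabelianGeometry.SemiGraphs.PSCSeparatingCoverings
import Mathlib.Algebra.Group.PUnit
import HarnessLib

/-!
# [CombGC] §1 over the bare interface: universal closures of seven typed predicates are FALSE

Mochizuki, *A combinatorial version of the Grothendieck conjecture*, Tohoku Math. J. **59** (2007)
[CombGC], §1: Definition 1.4 (iii) (edge-wise filtration-preserving isomorphisms, p. 10),
Theorem 1.6 (i) ("`α` is numerically cuspidal if and only if it is group-theoretically cuspidal",
p. 13) and the separating-coverings step of the PROOF of Proposition 1.2 (p. 9, typed by
abc-iut-w4-d081 as `PSCDatum.VerticialSeparatingCoverings` / `EdgeLikeSeparatingCoverings` /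
`UnrVerticialSeparatingCoverings` / `SeparatingCoverings` / `SeparatingCoveringsHolds Ω`, sub-DAG row
P12-L01 of the abc-iut cell).

All of these are typed over the INTERFACE `PSCDatum Π` of `PSCFundamentalGroup.lean`, whose module
docstring (`PSCGraphicity.lean`) already warns: "Propositions 1.2, 1.5 and Theorem 1.6 are theorems
about such `G` [of geometric origin] and are FALSE for arbitrary data satisfying the axioms of
`PSCDatum`".  The cell's FACT-LIST carries the seven declarations below as rows F-0446, F-0457,
F-2826, F-2827, F-2828, F-2829, F-2830.  This PROOF-ONLY file (no definition, no new fact) makes that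
warning kernel-visible: the UNIVERSAL CLOSURE of each of the seven is refuted by explicit degenerate
interface data — a `PSCDatum` over the trivial group `PUnit` (two vertices of genus `2`, resp. two
cusps, resp. one cusp against two cusps), over the order-two group `ULift ℤˣ` (one cusp against no
edge), and the origin predicate `Ω := ⊤` ("every datum is of PSC-type").  Consequently none of the
seven may be ASSUMED in closed (universally quantified) form by a certificate; the rows are
origin-level statements (FACT-policy of the cell: consumed BY NAME at a geometric origin — e.g.
abc-iut-w5-d183's reductions P12-L02/L03 take `G.SeparatingCoverings` as a hypothesis), resp. — for
Def. 1.4 (iii) — a DEFINITION that was never an assertion.  A refuted universal closure says nothing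
about the printed statements at their geometric instances; nothing here takes a side on [IUTchIII]
Cor. 3.12. [cite: MochizukiCombGC2007, §1 pp.8-13]
-/

namespace Literature.AnabelianGeometry.SemiGraphs

namespace PSCDatum

open scoped Pointwise

universe u

/-! ### Two small group-theoretic facts used by the countermodels -/

/-- Any set of primes containing the prime divisors of `|Π|` makes a FINITE topological group `Π`
pro-Σ in the sense of the interface (`IsProSigma`): the order of a quotient divides `|Π|`.
[cite: MochizukiCombGC2007, Def 1.1(ii) p.6] -/
theorem isProSigma_of_prime_dvd_card {Q : Type u} [Group Q] [TopologicalSpace Q] (S : Set ℕ)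
    (hS : ∀ p : ℕ, p.Prime → p ∣ Nat.card Q → p ∈ S) : IsProSigma S Q :=
  ⟨fun _ _ p hp hdvd => hS p hp (hdvd.trans (Subgroup.card_quotient_dvd_card _))⟩

/-- The trivial group is pro-Σ for every `Σ`. [cite: MochizukiCombGC2007, Def 1.1(ii) p.6] -/
theorem isProSigma_punit (S : Set ℕ) : IsProSigma S PUnit.{u + 1} :=
  isProSigma_of_prime_dvd_card S fun p hp hdvd => by
    rw [Nat.card_unique, Nat.dvd_one] at hdvd
    exact absurd hdvd hp.one_lt.ne'

/-! ### P12-L01 (separating coverings): rows F-2826, F-2828, F-2829, F-2830 -/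

/-- Countermodel A: over the trivial group `PUnit`, the datum with two vertices of genus `2`, no
edges, all subgroups `⊤`, `Σ` = all primes.  It is sturdy, and NEITHER the verticial NOR the
unramified-verticial separating-coverings statement holds for it: two distinct vertices can never be
separated because all subgroups of the trivial group coincide.
[cite: MochizukiCombGC2007, Prop 1.2 proof p.9] -/
theorem exists_sturdy_not_verticialSeparatingCoverings :
    ∃ G : PSCDatum PUnit.{u + 1}, G.IsSturdy ∧ ¬ G.VerticialSeparatingCoverings ∧
      ¬ G.UnrVerticialSeparatingCoverings ∧ ¬ G.SeparatingCoverings := by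
  let G : PSCDatum PUnit.{u + 1} :=
    { Sigma := {p | p.Prime}
      sigma_prime := fun _ hp => hp
      sigma_nonempty := ⟨2, Nat.prime_two⟩
      graph :=
        { V := Bool, N := Empty, C := Empty
          nodeEnds := fun e => Empty.elim e, cuspEnd := fun c => Empty.elim c }
      vertGp := fun _ => ⊤
      nodeGp := fun e => Empty.elim e
      cuspGp := fun c => Empty.elim c
      genus := fun _ => 2
      isClosed_vertGp := fun _ => isClosed_discrete _
      isClosed_nodeGp := fun e => Empty.elim e
      isClosed_cuspGp := fun c => Empty.elim c
      nodeGp_le := fun e => Empty.elim e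
      cuspGp_le := fun c => Empty.elim c
      proSigma := isProSigma_punit _ }
  have hst : G.IsSturdy := fun _ => le_rfl
  have hV : ¬ G.VerticialSeparatingCoverings := by
    intro h
    obtain ⟨V', -, -, -, hsep⟩ := h ⊤ inferInstance (isOpen_discrete _)
    obtain ⟨U, -, -, -, -, h₁⟩ := hsep true false 1 1 (Or.inl (by decide : true ≠ false))
    exact h₁ (le_of_eq (Subsingleton.elim _ _))
  have hU : ¬ G.UnrVerticialSeparatingCoverings := by
    intro h
    obtain ⟨V', -, -, -, hsep⟩ := h hst ⊤ inferInstance (isOpen_discrete _)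
    obtain ⟨U, -, -, -, -, h₁⟩ := hsep true false 1 1 (Or.inl (by decide : true ≠ false))
    exact h₁ (le_of_eq (Subsingleton.elim _ _))
  exact ⟨G, hst, hV, hU, fun h => hV h.1⟩

/-- **Row F-2826**: the universal closure of `VerticialSeparatingCoverings` over the interface is
false. [cite: MochizukiCombGC2007, Prop 1.2 proof p.9] -/
theorem not_forall_verticialSeparatingCoverings :
    ¬ ∀ (P : Type u) [Group P] [TopologicalSpace P] (G : PSCDatum P),
      G.VerticialSeparatingCoverings := fun h => by
  obtain ⟨G, -, hG, -⟩ := exists_sturdy_not_verticialSeparatingCoverings.{u}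
  exact hG (h PUnit.{u + 1} G)

/-- **Row F-2828**: the universal closure of `UnrVerticialSeparatingCoverings` over the interface is
false — even though the predicate is guarded by sturdiness (the countermodel is sturdy).
[cite: MochizukiCombGC2007, Prop 1.2 proof p.9] -/
theorem not_forall_unrVerticialSeparatingCoverings :
    ¬ ∀ (P : Type u) [Group P] [TopologicalSpace P] [IsTopologicalGroup P] (G : PSCDatum P),
      G.UnrVerticialSeparatingCoverings := fun h => by
  obtain ⟨G, -, -, hG, -⟩ := exists_sturdy_not_verticialSeparatingCoverings.{u}
  exact hG (h PUnit.{u + 1} G)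

/-- **Row F-2829**: the universal closure of `SeparatingCoverings` (the conjunction of the three
cases, sub-DAG row P12-L01) over the interface is false. [cite: MochizukiCombGC2007, Prop 1.2 proof p.9] -/
theorem not_forall_separatingCoverings :
    ¬ ∀ (P : Type u) [Group P] [TopologicalSpace P] [IsTopologicalGroup P] (G : PSCDatum P),
      G.SeparatingCoverings := fun h => by
  obtain ⟨G, -, -, -, hG⟩ := exists_sturdy_not_verticialSeparatingCoverings.{u}
  exact hG (h PUnit.{u + 1} G)

/-- **Row F-2830**: the closure over ALL origin predicates `Ω` of `SeparatingCoveringsHolds Ω` is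
false (take `Ω := ⊤`, "every datum is of PSC-type", and countermodel A).  At the other extreme the
empty origin satisfies every `…Holds` statement vacuously; the printed Prop. 1.2 lives at the
geometric origin, which the tree does not yet construct. [cite: MochizukiCombGC2007, Prop 1.2 proof p.9] -/
theorem not_forall_separatingCoveringsHolds :
    ¬ ∀ Ω : PSCOrigin.{u}, SeparatingCoveringsHolds Ω := fun h => by
  obtain ⟨G, -, -, -, hG⟩ := exists_sturdy_not_verticialSeparatingCoverings.{u}
  exact hG (h ⟨fun _ => True⟩ G trivial)

/-- The empty origin predicate satisfies `SeparatingCoveringsHolds` (vacuously): the `…Holds Ω` form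
is consistent, only its closure over `Ω` is not. [cite: MochizukiCombGC2007, Prop 1.2 proof p.9] -/
theorem separatingCoveringsHolds_of_empty_origin :
    SeparatingCoveringsHolds (⟨fun _ => False⟩ : PSCOrigin.{u}) :=
  fun _ _ _ _ _ h => h.elim

/-! ### P12-L01, edge-like case: row F-2827 -/

/-- Countermodel B: over the trivial group, one vertex with two cusps, all subgroups `⊤`; two distinct
cusps cannot be separated. [cite: MochizukiCombGC2007, Prop 1.2 proof p.9] -/
theorem exists_not_edgeLikeSeparatingCoverings :
    ∃ G : PSCDatum PUnit.{u + 1}, ¬ G.EdgeLikeSeparatingCoverings := by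
  let G : PSCDatum PUnit.{u + 1} :=
    { Sigma := {p | p.Prime}
      sigma_prime := fun _ hp => hp
      sigma_nonempty := ⟨2, Nat.prime_two⟩
      graph :=
        { V := Unit, N := Empty, C := Bool
          nodeEnds := fun e => Empty.elim e, cuspEnd := fun _ => () }
      vertGp := fun _ => ⊤
      nodeGp := fun e => Empty.elim e
      cuspGp := fun _ => ⊤
      genus := fun _ => 2
      isClosed_vertGp := fun _ => isClosed_discrete _
      isClosed_nodeGp := fun e => Empty.elim e
      isClosed_cuspGp := fun _ => isClosed_discrete _
      nodeGp_le := fun e => Empty.elim e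
      cuspGp_le := fun _ => ⟨1, le_top⟩
      proSigma := isProSigma_punit _ }
  refine ⟨G, fun h => ?_⟩
  obtain ⟨V', -, -, -, hsep⟩ := h ⊤ inferInstance (isOpen_discrete _)
  obtain ⟨U, -, -, -, -, h₁⟩ :=
    hsep (Sum.inr true) (Sum.inr false) 1 1
      (Or.inl (by simp : (Sum.inr true : Empty ⊕ Bool) ≠ Sum.inr false))
  exact h₁ (le_of_eq (Subsingleton.elim _ _))

/-- **Row F-2827**: the universal closure of `EdgeLikeSeparatingCoverings` over the interface is
false. [cite: MochizukiCombGC2007, Prop 1.2 proof p.9] -/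
theorem not_forall_edgeLikeSeparatingCoverings :
    ¬ ∀ (P : Type u) [Group P] [TopologicalSpace P] (G : PSCDatum P),
      G.EdgeLikeSeparatingCoverings := fun h => by
  obtain ⟨G, hG⟩ := exists_not_edgeLikeSeparatingCoverings.{u}
  exact hG (h PUnit.{u + 1} G)

/-! ### Theorem 1.6 (i) as a bare predicate: row F-0457 -/

/-- Countermodel C: over the trivial group, `G` = one vertex with ONE cusp, `H` = one vertex with TWO
cusps, all subgroups `⊤`, `α = id`.  Then `α` is group-theoretically cuspidal (both data have the
same — unique — cuspidal subgroup) but not numerically cuspidal (`r(G) = 1 ≠ 2 = r(H)`), so the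
biconditional of Thm. 1.6 (i) fails for these data. [cite: MochizukiCombGC2007, Thm 1.6(i) p.13] -/
theorem exists_not_numericallyCuspidalIffGroupTheoreticallyCuspidal :
    ∃ G H : PSCDatum PUnit.{u + 1},
      G.IsGroupTheoreticallyCuspidal H (ContinuousMulEquiv.refl _) ∧
      ¬ G.IsNumericallyCuspidal H (ContinuousMulEquiv.refl _) ∧
      ¬ G.NumericallyCuspidalIffGroupTheoreticallyCuspidal H (ContinuousMulEquiv.refl _) := by
  let G : PSCDatum PUnit.{u + 1} :=
    { Sigma := {p | p.Prime}
      sigma_prime := fun _ hp => hp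
      sigma_nonempty := ⟨2, Nat.prime_two⟩
      graph :=
        { V := Unit, N := Empty, C := Unit
          nodeEnds := fun e => Empty.elim e, cuspEnd := fun _ => () }
      vertGp := fun _ => ⊤
      nodeGp := fun e => Empty.elim e
      cuspGp := fun _ => ⊤
      genus := fun _ => 2
      isClosed_vertGp := fun _ => isClosed_discrete _
      isClosed_nodeGp := fun e => Empty.elim e
      isClosed_cuspGp := fun _ => isClosed_discrete _
      nodeGp_le := fun e => Empty.elim e
      cuspGp_le := fun _ => ⟨1, le_top⟩
      proSigma := isProSigma_punit _ }
  let H : PSCDatum PUnit.{u + 1} :=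
    { Sigma := {p | p.Prime}
      sigma_prime := fun _ hp => hp
      sigma_nonempty := ⟨2, Nat.prime_two⟩
      graph :=
        { V := Unit, N := Empty, C := Bool
          nodeEnds := fun e => Empty.elim e, cuspEnd := fun _ => () }
      vertGp := fun _ => ⊤
      nodeGp := fun e => Empty.elim e
      cuspGp := fun _ => ⊤
      genus := fun _ => 2
      isClosed_vertGp := fun _ => isClosed_discrete _
      isClosed_nodeGp := fun e => Empty.elim e
      isClosed_cuspGp := fun _ => isClosed_discrete _
      nodeGp_le := fun e => Empty.elim e
      cuspGp_le := fun _ => ⟨1, le_top⟩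
      proSigma := isProSigma_punit _ }
  have hgt : G.IsGroupTheoreticallyCuspidal H (ContinuousMulEquiv.refl _) :=
    ⟨fun _ _ => ⟨true, 1, Subsingleton.elim _ _⟩,
      fun B _ => ⟨⊤, ⟨(), 1, Subsingleton.elim _ _⟩, Subsingleton.elim _ _⟩⟩
  have hnum : ¬ G.IsNumericallyCuspidal H (ContinuousMulEquiv.refl _) := by
    intro h
    have h1 := h ⊤ (isOpen_discrete _)
    rw [show (⊤ : Subgroup PUnit.{u + 1}).map _ = ⊤ from Subsingleton.elim _ _,
      cuspCount_top, cuspCount_top] at h1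
    have h2 : Fintype.card Unit = Fintype.card Bool := h1
    simp at h2
  exact ⟨G, H, hgt, hnum, fun h => hnum (h.mpr hgt)⟩

/-- **Row F-0457**: the universal closure of the Thm. 1.6 (i) predicate
`NumericallyCuspidalIffGroupTheoreticallyCuspidal` over the interface is false (countermodel C).  The
printed theorem concerns data of geometric origin; its kernel derivation at `Σ = {l}` from the named
characterizations is abc-iut-w4-d052's `numericallyCuspidalIff_of_characterization`.
[cite: MochizukiCombGC2007, Thm 1.6(i) p.13] -/
theorem not_forall_numericallyCuspidalIffGroupTheoreticallyCuspidal :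
    ¬ ∀ (P : Type u) [Group P] [TopologicalSpace P] [IsTopologicalGroup P]
        (P' : Type u) [Group P'] [TopologicalSpace P'] [IsTopologicalGroup P']
        (G : PSCDatum P) (H : PSCDatum P') (α : P ≃ₜ* P'),
        G.NumericallyCuspidalIffGroupTheoreticallyCuspidal H α := fun h => by
  obtain ⟨G, H, -, -, hGH⟩ := exists_not_numericallyCuspidalIffGroupTheoreticallyCuspidal.{u}
  exact hGH (h _ _ G H (ContinuousMulEquiv.refl _))

/-! ### Definition 1.4 (iii), edge-wise filtration-preserving: row F-0446 -/

/-- Countermodel D: over the order-two group `ULift ℤˣ` (discrete, abelian), `G` = one vertex with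
one cusp, all subgroups `⊤`; `H` = one vertex, no edge; `α = id`.  Then `M^edge_G = M_G` (the cusp
group is everything) while `M^edge_H = 0`, so `α` is NOT edge-wise filtration-preserving: the
DEFINITION Def. 1.4 (iii) is not a property every isomorphism has.
[cite: MochizukiCombGC2007, Def 1.4(iii) p.10] -/
theorem exists_not_isEdgewiseFiltrationPreserving :
    ∃ G H : PSCDatum (ULift.{u} ℤˣ),
      ¬ G.IsEdgewiseFiltrationPreserving H (ContinuousMulEquiv.refl _) := by
  haveI : Nontrivial (ULift.{u} ℤˣ) :=
    ⟨⟨ULift.up 1, ULift.up (-1), fun h => absurd (ULift.up_injective h) (by decide)⟩⟩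
  have hpro : IsProSigma {p | p.Prime} (ULift.{u} ℤˣ) :=
    isProSigma_of_prime_dvd_card _ fun p hp _ => hp
  let G : PSCDatum (ULift.{u} ℤˣ) :=
    { Sigma := {p | p.Prime}
      sigma_prime := fun _ hp => hp
      sigma_nonempty := ⟨2, Nat.prime_two⟩
      graph :=
        { V := Unit, N := Empty, C := Unit
          nodeEnds := fun e => Empty.elim e, cuspEnd := fun _ => () }
      vertGp := fun _ => ⊤
      nodeGp := fun e => Empty.elim e
      cuspGp := fun _ => ⊤
      genus := fun _ => 2
      isClosed_vertGp := fun _ => isClosed_discrete _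
      isClosed_nodeGp := fun e => Empty.elim e
      isClosed_cuspGp := fun _ => isClosed_discrete _
      nodeGp_le := fun e => Empty.elim e
      cuspGp_le := fun _ => ⟨1, le_top⟩
      proSigma := hpro }
  let H : PSCDatum (ULift.{u} ℤˣ) :=
    { Sigma := {p | p.Prime}
      sigma_prime := fun _ hp => hp
      sigma_nonempty := ⟨2, Nat.prime_two⟩
      graph :=
        { V := Unit, N := Empty, C := Empty
          nodeEnds := fun e => Empty.elim e, cuspEnd := fun c => Empty.elim c }
      vertGp := fun _ => ⊤
      nodeGp := fun e => Empty.elim e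
      cuspGp := fun c => Empty.elim c
      genus := fun _ => 2
      isClosed_vertGp := fun _ => isClosed_discrete _
      isClosed_nodeGp := fun e => Empty.elim e
      isClosed_cuspGp := fun c => Empty.elim c
      nodeGp_le := fun e => Empty.elim e
      cuspGp_le := fun c => Empty.elim c
      proSigma := hpro }
  have hmap : ∀ X : Subgroup (ULift.{u} ℤˣ),
      X.map (ContinuousMulEquiv.refl (ULift.{u} ℤˣ)).toMulEquiv.toMonoidHom = X :=
    fun X => Subgroup.map_id X
  -- `M^edge_G = Π_G`: the cuspidal subgroup `⊤ = ⊤ ⊓ Π_c` is edge-like in `⊤`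
  have hG : G.edgeFil ⊤ = ⊤ := by
    refine top_le_iff.mp ?_
    have hE : G.IsEdgeLikeIn ⊤ ⊤ := ⟨⊤, Or.inr ⟨(), 1, (one_smul _ _).symm⟩, by simp⟩
    exact (le_iSup (fun A : {A : Subgroup (ULift.{u} ℤˣ) // G.IsEdgeLikeIn ⊤ A} =>
        (A : Subgroup (ULift.{u} ℤˣ))) ⟨⊤, hE⟩).trans
      (le_sup_right.trans (Subgroup.le_topologicalClosure _))
  -- `M^edge_H = 0`: no edge, abelian group
  have hH : H.edgeFil ⊤ = ⊥ := by
    refine le_bot_iff.mp ?_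
    unfold edgeFil
    refine Subgroup.topologicalClosure_minimal _ ?_ (isClosed_discrete _)
    refine sup_le ?_ (iSup_le fun A => ?_)
    · rw [Subgroup.commutator_le]
      intro a _ b _
      rw [commutatorElement_eq_one_iff_mul_comm.mpr (mul_comm a b)]
      exact (⊥ : Subgroup (ULift.{u} ℤˣ)).one_mem
    · obtain ⟨A, B, hB, -⟩ := A
      rcases hB with ⟨e, -⟩ | ⟨c, -⟩
      · exact Empty.elim e
      · exact Empty.elim c
  refine ⟨G, H, fun h => ?_⟩
  have h1 := h ⊤ (isOpen_discrete _)
  rw [hmap, hmap, hG, hH] at h1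
  exact top_ne_bot h1

/-- **Row F-0446**: the universal closure of the Def. 1.4 (iii) predicate
`IsEdgewiseFiltrationPreserving` is false (countermodel D) — as expected of a DEFINITION; in the
cell's cone it is a hypothesis of Thm. 1.6 (ii) ([CombGC] p. 14: "edge-wise filtration-preserving ⇒
group-theoretically edge-like", abc-iut-w4-d052's
`isGroupTheoreticallyEdgeLike_of_isEdgewiseFiltrationPreserving`), never a standalone assertion.
[cite: MochizukiCombGC2007, Def 1.4(iii) p.10] -/
theorem not_forall_isEdgewiseFiltrationPreserving :
    ¬ ∀ (P : Type u) [Group P] [TopologicalSpace P] [IsTopologicalGroup P]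
        (P' : Type u) [Group P'] [TopologicalSpace P'] [IsTopologicalGroup P']
        (G : PSCDatum P) (H : PSCDatum P') (α : P ≃ₜ* P'),
        G.IsEdgewiseFiltrationPreserving H α := fun h => by
  obtain ⟨G, H, hGH⟩ := exists_not_isEdgewiseFiltrationPreserving.{u}
  exact hGH (h _ _ G H (ContinuousMulEquiv.refl _))

end PSCDatum

end Literature.AnabelianGeometry.SemiGraphs
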